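import Summits.CriticalPhenomena.Ising3DConformalLimit.Theorems.SubPtolemyFloor.Negative.ExponentCharacterisation
import Literature.MathematicalPhysics.QuantumFieldTheory.CFTAxioms
import Literature.Probability.LatticeModels.PointwiseScalingLimitEtaExists
import HarnessLib

/-!
# Conditional closings of the crux `SubPtolemyFloor` BY NAME (line `Sketch-plus-wall-quotient-ladder`, lead c2)

What: the route's own foreseen two-layer bridge for its rank-3 crux
`Summit.CriticalPhenomena.Ising3DConformalLimit.Theses.SubPtolemyInterlacing.SubPtolemyFloor`
(item stmt-CriticalPhenomena-15703; route file, TWO-LAYER PLAN: "SubPtolemyFloor ⇐ (η exists as a power) →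
(η < 0.2716 given existence) → SubPtolemyFloor"), proved as theorems that conclude the crux BY NAME from
named hypotheses — so that the crux's exact conditional status is kernel-visible:

* `subPtolemyFloor_of_hasDecayExponent` — if the axial log-exponent `L` of `⟨σ₀σ_{n e₁}⟩_{β_c(3)}` exists
  (`HasDecayExponent`) and `L < log₂(1+√2)`, the crux holds (eventually `n^{-a} ≤ g(n)` for `L < a < log₂(1+√2)`,
  `a ≥ 0`; the finitely many small `n` are absorbed into `c = g(N) ≤ 1` by Messager–Miracle-Solé axial
  monotonicity). This is the converse of the landed `SubPtolemyFloorNegative.exponent_lt_threshold_of_crux`.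
* `hasDecayExponent_axis_of_hasSpatialDecayExponent` — a spatial (all-directions, `cofinite`) log-exponent
  restricts to the axis.
* `subPtolemyFloor_of_hasIsingExponentEta` — **η(3) exists and η(3) < log₂(1+√2) − 1 = 0.2716 ⇒ crux.**
* `subPtolemyFloor_of_hasIsingEtaBounds` — the same from two-sided power bounds (no limit needed).
* `subPtolemyFloor_of_critIsing3DExponentValues` — **the registered OPEN CONJECTURE crit-ising.S23
  `Literature.MathematicalPhysics.QuantumFieldTheory.CritIsing3DExponentValues` (Ising₃ scaling limit is the
  bootstrap CFT; in particular η exists and `η ∈ [0.0362958, 0.0362998]`) implies the crux** — a CONDITIONAL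
  result on a named conjecture (the gate records it as such; it does not close the item).

Why: unconditionally the crux is the open problem "one-sided `η(3) < 0.2716`" (best rigorous: all-`n` exponent
`2`, Simon–Lieb; liminf exponent `3/2`, this line's `frequently_rpow_le_criticalTwoPoint_axis`; conditional on
η-existence only `η ≤ 1/2`, Duminil-Copin–Panis 2025 Thm 1.5, and `3/2 > log₂(1+√2)`); these theorems pin down
exactly which standard conjectural input discharges it, in the tree's vocabulary, for the planners.

Sources: route file `Theses/SubPtolemyInterlacing.lean` (two-layer plan); `Literature/MathematicalPhysics/
QuantumFieldTheory/CFTAxioms.lean` (S23 and its API `CritIsing3DExponentValues.exists_hasIsingExponentEta`);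
Kos–Poland–Simmons-Duffin–Vichi 2016 §1 (`η = 0.0362978(20)`); Messager–Miracle-Solé 1977 (axial monotonicity,
tree `criticalTwoPoint_axis_antitone`); the crux disprover's `Cruxes/SubPtolemyFloor/Disproof.lean` §3
(`crux_iff_of_hasDecayExponent`, whose `←` direction is re-proved here as an importable theorem).
-/

noncomputable section

namespace Summit.CriticalPhenomena.Ising3DConformalLimit.SubPtolemyFloorPlusWall

open Literature.Probability.LatticeModels Filter Set
open Summit.CriticalPhenomena.Ising3DConformalLimit.Theses
open Summit.CriticalPhenomena.Ising3DConformalLimit.Theses.SubPtolemyInterlacing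
open scoped Topology

/-! ## From an axial exponent below the threshold -/

/-- **An axial log-exponent `L < log₂(1+√2)` gives the crux.** If `log ⟨σ₀σ_{n e₁}⟩_{β_c(3)} / log n → -L`
with `L < log₂(1+√2)`, then `SubPtolemyFloor`: for `a := max 0 ((L + log₂(1+√2))/2)` eventually
`n^{-a} ≤ g(n)`, and the finitely many small `n` are absorbed into the constant `c = g(N) ≤ 1` by axial
monotonicity. (Converse of `SubPtolemyFloorNegative.exponent_lt_threshold_of_crux`; adapted from the crux
disprover's `crux_iff_of_hasDecayExponent`.) [cite: MessagerMiracleSoleJSP1977, main theorem (monotonicity of ⟨σ₀σ_x⟩ under reflections)] -/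
theorem subPtolemyFloor_of_hasDecayExponent :
    ∀ L : ℝ, HasDecayExponent (fun m : ℕ => criticalTwoPoint 3 (Pi.single 0 (m : ℤ))) L →
      L < Real.logb 2 (1 + Real.sqrt 2) → SubPtolemyFloor := by
  intro L hL hLT
  set T := Real.logb 2 (1 + Real.sqrt 2) with hT
  set a : ℝ := max 0 ((L + T) / 2) with ha
  have hT1 : 1 < T := SubPtolemyFloorNegative.one_lt_threshold
  have haT : a < T := max_lt (by linarith) (by linarith)
  have hLa : L < a := lt_of_lt_of_le (by linarith) (le_max_right _ _)
  have ha0 : 0 ≤ a := le_max_left _ _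
  have hev : ∀ᶠ n : ℕ in atTop,
      -a < Real.log (criticalTwoPoint 3 (Pi.single 0 (n : ℤ))) / Real.log n :=
    hL.eventually_const_lt (by linarith)
  obtain ⟨N, hN⟩ := eventually_atTop.1 (hev.and (eventually_ge_atTop 2))
  have hge : ∀ n : ℕ, N ≤ n → (n : ℝ) ^ (-a) ≤ criticalTwoPoint 3 (Pi.single 0 (n : ℤ)) := by
    intro n hn
    obtain ⟨h1, h2⟩ := hN n hn
    have hn0 : (0 : ℝ) < n := by exact_mod_cast (by omega : 0 < n)
    have hlogn : 0 < Real.log n := Real.log_pos (by exact_mod_cast (by omega : 1 < n))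
    have hgpos := criticalTwoPoint_axis_pos n
    rw [lt_div_iff₀ hlogn] at h1
    have h3 : Real.log ((n : ℝ) ^ (-a)) < Real.log (criticalTwoPoint 3 (Pi.single 0 (n : ℤ))) := by
      rw [Real.log_rpow hn0]; exact h1
    exact ((Real.log_lt_log_iff (Real.rpow_pos_of_pos hn0 _) hgpos).1 h3).le
  have hN1 : 1 ≤ N := by have := (hN N le_rfl).2; omega
  refine ⟨a, criticalTwoPoint 3 (Pi.single 0 (N : ℤ)), haT, criticalTwoPoint_axis_pos N,
    fun n hn => ?_⟩
  rw [zsmul_single_zero_one]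
  have hn0 : (0 : ℝ) < n := by exact_mod_cast hn
  have hgN1 : criticalTwoPoint 3 (Pi.single 0 (N : ℤ)) ≤ 1 := criticalTwoPoint_le_one' _
  have hgN0 : 0 ≤ criticalTwoPoint 3 (Pi.single 0 (N : ℤ)) := (criticalTwoPoint_axis_pos N).le
  have hpow1 : (n : ℝ) ^ (-a) ≤ 1 :=
    Real.rpow_le_one_of_one_le_of_nonpos (by exact_mod_cast hn) (by linarith)
  have hpow0 : 0 ≤ (n : ℝ) ^ (-a) := Real.rpow_nonneg hn0.le _
  rcases le_or_gt N n with hle | hlt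
  · calc criticalTwoPoint 3 (Pi.single 0 (N : ℤ)) * (n : ℝ) ^ (-a)
        ≤ 1 * (n : ℝ) ^ (-a) := mul_le_mul_of_nonneg_right hgN1 hpow0
      _ = (n : ℝ) ^ (-a) := one_mul _
      _ ≤ criticalTwoPoint 3 (Pi.single 0 (n : ℤ)) := hge n hle
  · calc criticalTwoPoint 3 (Pi.single 0 (N : ℤ)) * (n : ℝ) ^ (-a)
        ≤ criticalTwoPoint 3 (Pi.single 0 (N : ℤ)) * 1 := mul_le_mul_of_nonneg_left hpow1 hgN0
      _ = criticalTwoPoint 3 (Pi.single 0 (N : ℤ)) := mul_one _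
      _ ≤ criticalTwoPoint 3 (Pi.single 0 (n : ℤ)) := criticalTwoPoint_axis_antitone hlt.le

/-! ## From the anomalous dimension `η(3)` -/

/-- A spatial log-exponent of the critical two-point function (`log G(x)/log ‖x‖ → -κ` along `cofinite`)
restricts to the first axis (`n ↦ n e₁` is injective and `‖n e₁‖ = n`). [folklore] -/
theorem hasDecayExponent_axis_of_hasSpatialDecayExponent {κ : ℝ}
    (h : HasSpatialDecayExponent (criticalTwoPoint 3) κ) :
    HasDecayExponent (fun m : ℕ => criticalTwoPoint 3 (Pi.single 0 (m : ℤ))) κ := by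
  have hf : Function.Injective (fun m : ℕ => (Pi.single 0 (m : ℤ) : Site 3)) :=
    fun m₁ m₂ hm => by
      have := congr_fun hm 0
      simpa using this
  have h2 := h.comp hf.tendsto_cofinite
  rw [Nat.cofinite_eq_atTop] at h2
  refine h2.congr' (Eventually.of_forall fun m => ?_)
  simp only [Function.comp_apply, Pi.norm_single, Int.norm_natCast]

/-- **η(3) exists and `η(3) < log₂(1+√2) − 1 = 0.2716…` ⇒ the crux** (the route's two-layer bridge:
`HasIsingExponentEta 3 η` is `log ⟨σ₀σ_x⟩_{β_c} / log ‖x‖ → -(1 + η)`; restrict to the axis and apply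
`subPtolemyFloor_of_hasDecayExponent` with `L = 1 + η`). Truth `η = 0.036`; rigorous: `η ≤ 1/2` IF it exists
(Duminil-Copin–Panis 2025, Thm 1.5) — so the η-window `(0.2716, 0.5]` is what a refutation through an exponent
would have to realise. [cite: DuminilCopinPanis2025LowerBounds, Theorem 1.5] -/
theorem subPtolemyFloor_of_hasIsingExponentEta :
    ∀ η : ℝ, HasIsingExponentEta 3 η → η < Real.logb 2 (1 + Real.sqrt 2) - 1 → SubPtolemyFloor := by
  intro η hη hlt
  have h : HasSpatialDecayExponent (criticalTwoPoint 3) (((3 : ℕ) : ℝ) - 2 + η) := hη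
  refine subPtolemyFloor_of_hasDecayExponent _ (hasDecayExponent_axis_of_hasSpatialDecayExponent h) ?_
  push_cast
  linarith

/-- **Two-sided power bounds with `η < 0.2716…` ⇒ the crux**, directly (no limit: the lower bound
`c‖x‖^{-(1+η)} ≤ ⟨σ₀σ_x⟩_{β_c}` IS an axial floor with exponent `1 + η`). [folklore] -/
theorem subPtolemyFloor_of_hasIsingEtaBounds :
    ∀ η : ℝ, HasIsingEtaBounds 3 η → η < Real.logb 2 (1 + Real.sqrt 2) - 1 → SubPtolemyFloor := by
  rintro η ⟨c, C, hc, hb⟩ hlt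
  refine ⟨1 + η, c, by linarith, hc, fun n hn => ?_⟩
  have h := (hb _ (SubPtolemyFloorNegative.axis_ne_zero (d := 3) hn)).1
  rw [Site.norm_eq_supNorm, SubPtolemyFloorNegative.supNorm_axis] at h
  convert h using 2
  push_cast
  ring

/-! ## From the registered open conjecture crit-ising.S23 (bootstrap exponent values) -/

/-- `0.0362998 < log₂(1+√2) - 1` (indeed `5/4 < log₂(1+√2)`, landed `five_fourths_lt_threshold`). [folklore] -/
theorem bootstrapEta_lt_threshold_sub_one : (0.0362998 : ℝ) < Real.logb 2 (1 + Real.sqrt 2) - 1 := by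
  have := SubPtolemyFloorNegative.five_fourths_lt_threshold
  linarith

/-- **CONDITIONAL: the open conjecture crit-ising.S23 implies the crux.** Under
`CritIsing3DExponentValues` (the critical Ising₃ correlators converge to the bootstrap Ising CFT; in
particular `η(3)` exists with `η = 2Δ_σ - 1 ∈ [0.0362958, 0.0362998]`,
`CritIsing3DExponentValues.exists_hasIsingExponentEta`), `SubPtolemyFloor` holds, since
`0.0363 < 0.2716 = log₂(1+√2) - 1`. S23 is a registered OPEN CONJECTURE (`@[conjecture] def`, never asserted):
this theorem is a conditional result and does not close the item; it records that the crux is downstream of the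
standard conjectural picture (and, by `SubPtolemyFloorNegative.not_crux_of_limit_of_threshold_le`, that a
refutation would need `Δ_σ ≥ 0.6358` against the bootstrap `0.5181489(10)`).
[cite: KosPolandSimmonsDuffinVichi2016, §1 and Table 2 (Δ_σ = 0.5181489(10), η = 0.0362978(20))] -/
theorem subPtolemyFloor_of_critIsing3DExponentValues :
    Literature.MathematicalPhysics.QuantumFieldTheory.CritIsing3DExponentValues → SubPtolemyFloor := by
  intro H
  obtain ⟨η, ⟨-, hη2⟩, hη⟩ := H.exists_hasIsingExponentEta
  exact subPtolemyFloor_of_hasIsingExponentEta η hη (hη2.trans_lt bootstrapEta_lt_threshold_sub_one)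

end Summit.CriticalPhenomena.Ising3DConformalLimit.SubPtolemyFloorPlusWall

end
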